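import Summits.ResolutionOfSingularities.ResolutionOfSingularities.Theorems.PurelyInseparableDim4ResConeShadeTwoLedger
import Summits.ResolutionOfSingularities.ResolutionOfSingularities.Theorems.PurelyInseparableDim4FreeTailLemma
import HarnessLib
import HarnessLib.Audit.Tags

/-!
# Purely inseparable four-folds — K2(p), PHASE `d = 2`, PART IV: NO CORNER TRAP (every prime, both values of `e_G`;
# idea-4 «TWO-LETTER LEMMA» I-4-5 (G3)/(G4), made `p`-free, + FT)

[OURS · counted 0 · cell `res-dim4-pi` · seat res-dim4-p-7 g3 · K2(p) lane (holder res-dim4-p-12 lineage; desk WORD #82 (c));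
hand analysis res-dim4-idea-4 (cards I-4-4 / I-4-5).]  Nothing here proves K2(p), `NoIsolatedTrap p p`, or resolution of
singularities in dimension ≥ 4 / characteristic `p`.  AI kernel work, weaker than expert review.

**`no_shadeTwo_corner_chain`**: over a field of characteristic `p` there is no witnessed `Step0 p` chain of ISOLATED states, all
off the floor, of constant shade `2`, with `x^{r₀} ∣ F₀`, whose steps are eventually all CORNER steps (`b_k = 0`).  Assembly:
`run_lemma` (at constant ledger and stable quadric, a run of one chart letter between two changes of chart has length one, the
surrounding letters agree, and it leaves a pure cube / pure fifth power one / two steps before), `no_corner_chain_of_r_const`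
(two consecutive runs put a pure fifth power right after a foreign step — impossible; the changes of chart come from FT =
`FreeTailProof.noIsolatedFreeTailAt_self`), `no_corner_chain_of_coweight_le` (induction on `W₀`: `W` is non-increasing once
every chart letter has co-weight `≤ p − 2`), and the re-rooting past the first change of chart.  The translated steps (free
translations / lost boundary letters) are NOT treated here.
bears_on: LADDER-RESOLUTION:D157-DOOR2 (res-dim4-pi · K2(p) · phase d = 2).  Supports stmt-ResolutionOfSingularities-16155
(helper).
-/

set_option linter.dupNamespace false -- mandated namespace of this single-conjunct summit

noncomputable section

namespace Summit.ResolutionOfSingularities.ResolutionOfSingularities.Theorems.PIDim4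

namespace ResCone

open MvPolynomial Finset
open Literature.AlgebraicGeometry.Resolution
open Literature.AlgebraicGeometry.Resolution.CentreBlowup
open Literature.AlgebraicGeometry.Resolution.Hauser2010
open Literature.AlgebraicGeometry.Resolution.HauserPerlega2019

variable {K : Type} [Field K] [DecidableEq K]

section Corner

variable {p : ℕ} [hp : Fact p.Prime] {c : ℕ → State K} {j : ℕ → Fin 4} {b : ℕ → Fin 4 → K}

section Endgame

variable {r : Fin 4 →₀ ℕ} {W : ℕ} {S₂ : Finset (Fin 4 →₀ ℕ)} {T : ℕ}

/-- **THE RUN LEMMA**: at constant ledger with stable quadric (from `T`), let `T ≤ t₀` carry a change of chart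
`j t₀ ≠ j (t₀+1) =: a`, let the chart stay `a` on `[t₀+1, t₁]` and change again at `t₁` (`j (t₁+1) ≠ a`).  Then the run has
length one (`t₁ = t₀ + 1`), the surrounding letters agree (`j (t₁+1) = j t₀`), `x^{r+3e_a} ∈ supp F_{t₀}`, and if moreover
`T + 1 ≤ t₀` then `j (t₀ − 1) = a` with `x^{r + 5e_a} ∈ supp F_{t₀−1}`. [OURS · K2(p) phase d = 2] [folklore] -/
theorem run_lemma (hw : FreeTail.IsWitnessedChain p c j b)
    (hc : ∀ k, IsIsolated p (c k).F ∧ Step0 p (c k) (c (k + 1)) ∧ ordZero (c k).F ≠ p ∧ (c k).shade = 2)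
    (hr0 : ∀ e ∈ (c 0).F.support, (c 0).r ≤ e) (hb : ∀ k, b k = 0) (hrr : ∀ k, (c k).r = r) (hW : r.degree = W)
    (hcw : ∀ k, r (j k) + p = W + 2) (hS : ∀ k, T ≤ k → (resForm (c k)).support = S₂)
    {t₀ t₁ : ℕ} (ht₀ : T ≤ t₀) (hlt : t₀ < t₁) (hch₀ : j t₀ ≠ j (t₀ + 1))
    (hrun : ∀ t, t₀ < t → t ≤ t₁ → j t = j (t₀ + 1)) (hch₁ : j (t₁ + 1) ≠ j (t₀ + 1)) :
    t₁ = t₀ + 1 ∧ j (t₁ + 1) = j t₀ ∧ r + Finsupp.single (j (t₀ + 1)) 3 ∈ (c t₀).F.support ∧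
      (T + 1 ≤ t₀ → j (t₀ - 1) = j (t₀ + 1) ∧ r + Finsupp.single (j (t₀ + 1)) 5 ∈ (c (t₀ - 1)).F.support) := by
  generalize ha_def : j (t₀ + 1) = a at hrun hch₀ hch₁
  -- `a` is free in the stable quadric (it is the chart letter at `t₁ ≥ T`)
  have hat₁ : j t₁ = a := hrun t₁ hlt le_rfl
  have haS : ∀ μ ∈ S₂, μ a = 0 := by
    intro μ hμ
    have h := (corner_quadric hw hc hr0 hb t₁).2.1 μ (by rw [hS t₁ (by omega)]; exact hμ)
    rwa [hat₁] at h
  have hra : r a + p = W + 2 := by have := hcw (t₀ + 1); rwa [ha_def] at this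
  have hne₁ : a ≠ j (t₁ + 1) := fun h => hch₁ h.symm
  have hne₀ : a ≠ j t₀ := fun h => hch₀ h.symm
  -- Step 1: axis witness for `a` two steps after the change `a → c`
  obtain ⟨m'', hm'', -, hlt''⟩ := exists_axis_witness hc hr0 (t₁ + 2) a
  rw [hrr] at hm'' hlt''
  rw [hW] at hlt''
  have hlow : m''.degree ≤ m'' a + 1 := by omega
  -- Step 2: low witness after the foreign step `t₁ + 1`
  rcases low_witness_after_foreign_step hw hc hr0 hb hrr hS (k := t₁ + 1) (by omega) hne₁ haS hm'' hlow with
    ⟨-, h3⟩ | ⟨-, h21⟩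
  · -- case (i): a pure cube at `t₁ + 1`, pure powers down the run, none right after the foreign step `t₀`
    exfalso
    have htrans : ∀ i, i ≤ t₁ - t₀ → r + Finsupp.single a (3 + 2 * i) ∈ (c (t₁ + 1 - i)).F.support := by
      intro i
      induction i with
      | zero => intro _; simpa using h3
      | succ i ih =>
        intro hi
        have hmem := ih (by omega)
        have hjt : j (t₁ - i) = a := hrun (t₁ - i) (by omega) (by omega)
        have hst := (own_step_source hw hc hr0 hb hrr (t₁ - i)).2 (3 + 2 * i)
        rw [hjt, show t₁ - i + 1 = t₁ + 1 - i by omega] at hst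
        rw [show t₁ + 1 - (i + 1) = t₁ - i by omega, show 3 + 2 * (i + 1) = 3 + 2 * i + 2 by ring]
        exact hst hmem
    have hlast := htrans (t₁ - t₀) le_rfl
    rw [show t₁ + 1 - (t₁ - t₀) = t₀ + 1 by omega] at hlast
    exact no_pure_power_after_foreign_step hw hc hr0 hb hrr hS ht₀ hne₀ haS (n := 3 + 2 * (t₁ - t₀)) (by omega) hlast
  · -- case (ii): `x^{r + 2e_a + e_c}` at `t₁ + 1`, pulled back through the run to `t₀ + 1`
    have htrans : ∀ i, i ≤ t₁ - t₀ →
        r + Finsupp.single a (2 + i) + Finsupp.single (j (t₁ + 1)) 1 ∈ (c (t₁ + 1 - i)).F.support := by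
      intro i
      induction i with
      | zero => intro _; simpa using h21
      | succ i ih =>
        intro hi
        have hmem := ih (by omega)
        have hjt : j (t₁ - i) = a := hrun (t₁ - i) (by omega) (by omega)
        have hst := (own_step_source hw hc hr0 hb hrr (t₁ - i)).1 (j (t₁ + 1)) (2 + i)
        rw [hjt, show t₁ - i + 1 = t₁ + 1 - i by omega] at hst
        rw [show t₁ + 1 - (i + 1) = t₁ - i by omega, show 2 + (i + 1) = 2 + i + 1 by ring]
        exact hst (Ne.symm hne₁) hmem
    have hlast := htrans (t₁ - t₀) le_rfl
    rw [show t₁ + 1 - (t₁ - t₀) = t₀ + 1 by omega] at hlast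
    -- the source at the foreign step `t₀`
    have hm1 : (c (t₀ + 1)).r + (Finsupp.single a (2 + (t₁ - t₀)) + Finsupp.single (j (t₁ + 1)) 1) ∈
        (c (t₀ + 1)).F.support := by
      rw [hrr, ← add_assoc]; exact hlast
    obtain ⟨m, hm, hm2, hupd⟩ := corner_source hw hc hr0 hb t₀ hm1
    obtain ⟨hmj, hmi⟩ := apply_of_eq_update hupd
    have hma : m a = 2 + (t₁ - t₀) := by
      have := hmi a hne₀
      rw [Finsupp.add_apply, Finsupp.single_eq_same, Finsupp.single_apply, if_neg (Ne.symm hne₁), add_zero] at this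
      exact this.symm
    -- the surrounding letters agree
    have hcc : j (t₁ + 1) = j t₀ := by
      by_contra hcc
      have h1 : m (j (t₁ + 1)) = 1 := by
        have := hmi (j (t₁ + 1)) hcc
        rw [Finsupp.add_apply, Finsupp.single_apply, if_neg hne₁, Finsupp.single_eq_same, zero_add] at this
        exact this.symm
      have h3 : m.degree = 2 := by
        rw [Finsupp.add_apply, Finsupp.single_apply, if_neg hne₀, Finsupp.single_apply, if_neg hcc, add_zero] at hmj
        omega
      have := apply_add_apply_le_degree m hne₁
      omega
    -- hence `|m| = 3`, the run has length one and the source is the pure cube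
    have hdegm : m.degree = 3 := by
      rw [Finsupp.add_apply, Finsupp.single_apply, if_neg hne₀, hcc, Finsupp.single_eq_same, zero_add] at hmj
      omega
    have ht₁ : t₁ = t₀ + 1 := by have := Finsupp.le_degree a m; omega
    have hm0 : ∀ i, i ≠ a → m i = 0 := by
      intro i hia
      have := apply_add_apply_le_degree m (a := a) (c := i) (fun h => hia h.symm)
      omega
    have hmeq : m = Finsupp.single a 3 := by
      rw [eq_single_of_forall m hm0, hma, ht₁, show 2 + (t₀ + 1 - t₀) = 3 by omega]
    have hcube : r + Finsupp.single a 3 ∈ (c t₀).F.support := by rw [← hrr t₀, ← hmeq]; exact hm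
    refine ⟨ht₁, hcc, hcube, fun hT => ?_⟩
    -- Step 4: one step further back
    have ht : t₀ - 1 + 1 = t₀ := by omega
    have hcube' : r + Finsupp.single a 3 ∈ (c (t₀ - 1 + 1)).F.support := by rw [ht]; exact hcube
    have hprev : j (t₀ - 1) = a := by
      by_contra hne
      exact no_pure_power_after_foreign_step hw hc hr0 hb hrr hS (k := t₀ - 1) (by omega) (fun h => hne h.symm) haS
        (n := 3) (by omega) hcube'
    refine ⟨hprev, ?_⟩
    have hst := (own_step_source hw hc hr0 hb hrr (t₀ - 1)).2 3
    rw [hprev] at hst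
    exact hst hcube'

/-- **No all-corner shade-2 chain with constant ledger.** [OURS · K2(p) phase d = 2] [folklore] -/
theorem no_corner_chain_of_r_const [CharP K p] (hw : FreeTail.IsWitnessedChain p c j b)
    (hc : ∀ k, IsIsolated p (c k).F ∧ Step0 p (c k) (c (k + 1)) ∧ ordZero (c k).F ≠ p ∧ (c k).shade = 2)
    (hr0 : ∀ e ∈ (c 0).F.support, (c 0).r ≤ e) (hb : ∀ k, b k = 0) (hrr : ∀ k, (c k).r = r) : False := by
  classical
  have hcw : ∀ k, r (j k) + p = r.degree + 2 := by
    intro k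
    obtain ⟨-, -, hdeg, -⟩ := corner_step hw hc hr0 hb k
    rw [hrr, hrr] at hdeg
    omega
  obtain ⟨T, hT⟩ := support_resForm_eventually_const hw hc hr0 hb
  have hFT := (FreeTail.satelliteRecurrenceAt_iff_noIsolatedFreeTailAt p p).mpr
    (FreeTailProof.noIsolatedFreeTailAt_self p)
  have hchange : ∀ k₀, ∃ k, k₀ ≤ k ∧ j (k + 1) ≠ j k := fun k₀ => by
    obtain ⟨k, hk, hsat⟩ := hFT K c j b hw (fun k => (hc k).1) k₀
    exact ⟨k, hk, hsat.1⟩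
  -- the next change of chart after a given index, and the constancy of the chart before it
  have hnext : ∀ t₀, ∃ t₁, t₀ < t₁ ∧ j (t₁ + 1) ≠ j t₁ ∧ ∀ t, t₀ < t → t ≤ t₁ → j t = j (t₀ + 1) := by
    intro t₀
    have hex : ∃ k, t₀ + 1 ≤ k ∧ j (k + 1) ≠ j k := hchange (t₀ + 1)
    refine ⟨Nat.find hex, (Nat.find_spec hex).1, (Nat.find_spec hex).2, ?_⟩
    have hmin : ∀ t, t₀ + 1 ≤ t → t < Nat.find hex → j (t + 1) = j t := by
      intro t h1 h2
      have h := Nat.find_min hex h2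
      by_contra hne
      exact h ⟨h1, hne⟩
    intro t ht hle
    induction t with
    | zero => omega
    | succ t ih =>
      rcases Nat.lt_or_ge t₀ t with hlt | hge
      · rw [hmin t (by omega) (by omega), ih hlt (by omega)]
      · have : t = t₀ := by omega
        subst this
        rfl
  -- first change at `t₀ ≥ T + 1`, then two consecutive runs
  obtain ⟨t₀, ht₀, hch₀⟩ := hchange (T + 1)
  obtain ⟨t₁, hlt₁, hch₁, hrun₁⟩ := hnext t₀
  have hch₁' : j (t₁ + 1) ≠ j (t₀ + 1) := by rw [← hrun₁ t₁ hlt₁ le_rfl]; exact hch₁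
  obtain ⟨ht₁, -, -, hback⟩ := run_lemma hw hc hr0 hb hrr rfl hcw hT (by omega) hlt₁ (Ne.symm hch₀) hrun₁ hch₁'
  obtain ⟨hprev, -⟩ := hback (by omega)
  -- second run, starting at the change `t₀ + 1`
  obtain ⟨t₂, hlt₂, hch₂, hrun₂⟩ := hnext (t₀ + 1)
  have hch₀' : j (t₀ + 1) ≠ j (t₀ + 1 + 1) := by
    have h := hch₁'
    rw [ht₁] at h
    exact h.symm
  have hch₂' : j (t₂ + 1) ≠ j (t₀ + 1 + 1) := by rw [← hrun₂ t₂ hlt₂ le_rfl]; exact hch₂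
  obtain ⟨-, -, -, hback'⟩ := run_lemma hw hc hr0 hb hrr rfl hcw hT (by omega) hlt₂ hch₀' hrun₂ hch₂'
  obtain ⟨-, hfive⟩ := hback' (by omega)
  -- a pure fifth power of `c = j (t₀ + 2)` right after the foreign step `t₀ − 1` (chart `a`)
  rw [show t₀ + 1 - 1 = t₀ - 1 + 1 by omega] at hfive
  have hcS : ∀ μ ∈ (resForm (c T)).support, μ (j (t₀ + 1 + 1)) = 0 := by
    intro μ hμ
    exact (corner_quadric hw hc hr0 hb (t₀ + 1 + 1)).2.1 μ (by rw [hT (t₀ + 1 + 1) (by omega)]; exact hμ)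
  have hne : j (t₀ + 1 + 1) ≠ j (t₀ - 1) := by
    have h := hch₁'
    rw [ht₁] at h
    rw [hprev]
    exact h
  exact no_pure_power_after_foreign_step hw hc hr0 hb hrr hT (k := t₀ - 1) (by omega) hne hcS (n := 5)
    (by omega) hfive


end Endgame

/-- **No all-corner shade-2 chain whose chart letters all have co-weight `≤ p − 2`** (induction on `W₀`: `W` is
non-increasing; at the first drop re-root, else the ledger is constant). [OURS · K2(p) phase d = 2] [folklore] -/
theorem no_corner_chain_of_coweight_le [CharP K p] (n : ℕ) :
    ∀ (c : ℕ → State K) (j : ℕ → Fin 4) (b : ℕ → Fin 4 → K), FreeTail.IsWitnessedChain p c j b →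
      (∀ k, IsIsolated p (c k).F ∧ Step0 p (c k) (c (k + 1)) ∧ ordZero (c k).F ≠ p ∧ (c k).shade = 2) →
      (∀ e ∈ (c 0).F.support, (c 0).r ≤ e) → (∀ k, b k = 0) →
      (∀ k, (c k).r.degree + 2 ≤ (c k).r (j k) + p) → (c 0).r.degree ≤ n → False := by
  induction n with
  | zero =>
    intro c j b hw hc hr0 hb H hn
    have hc2 : ∀ k, IsIsolated p (c k).F ∧ Step0 p (c k) (c (k + 1)) := fun k => ⟨(hc k).1, (hc k).2.1⟩
    obtain ⟨-, hpW, -⟩ := shadeTwo_letters p hc hr0 0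
    have hp2 : 2 ≤ p := hp.out.two_le
    omega
  | succ n ih =>
    intro c j b hw hc hr0 hb H hn
    have hc2 : ∀ k, IsIsolated p (c k).F ∧ Step0 p (c k) (c (k + 1)) := fun k => ⟨(hc k).1, (hc k).2.1⟩
    have hanti1 : ∀ k, (c (k + 1)).r.degree ≤ (c k).r.degree := fun k => by
      obtain ⟨-, -, hdeg, -⟩ := corner_step hw hc hr0 hb k
      have := H k
      omega
    by_cases hconst : ∀ k, (c k).r.degree = (c 0).r.degree
    · -- constant weight: the ledger is constant
      have hrr : ∀ k, (c k).r = (c 0).r := by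
        intro k
        induction k with
        | zero => rfl
        | succ k ihk =>
          obtain ⟨-, hr', hdeg, -⟩ := corner_step hw hc hr0 hb k
          obtain ⟨-, hpW, -⟩ := shadeTwo_letters p hc hr0 k
          have hk1 := hconst (k + 1)
          have hk0 := hconst k
          have hjk : (c k).r.degree + 2 - p = (c k).r (j k) := by omega
          rw [hr', hjk, Finsupp.update_self, ihk]
      exact no_corner_chain_of_r_const hw hc hr0 hb hrr
    · push Not at hconst
      obtain ⟨k, hk⟩ := hconst
      have hmono : Antitone fun k => (c k).r.degree := antitone_nat_of_succ_le hanti1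
      have hle : (c k).r.degree ≤ (c 0).r.degree := hmono (Nat.zero_le k)
      have hlt : (c k).r.degree < (c 0).r.degree := lt_of_le_of_ne hle hk
      refine ih (fun i => c (k + i)) (fun i => j (k + i)) (fun i => b (k + i)) (fun i => hw (k + i))
        (fun i => hc (k + i)) (IsolatedBand.isolated_chain_forall_le hc2 hr0 k) (fun i => hb (k + i))
        (fun i => H (k + i)) ?_
      show (c k).r.degree ≤ n
      omega

end Corner


/-! ## §4 No corner trap at `d = 2` -/

/-- **K2(p), PHASE `d = 2`: NO CORNER TRAP** (every prime `p`, both values of `e_G`): over a field of characteristic `p`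
there is no witnessed `Step0 p` chain of ISOLATED states with `x^{r₀} ∣ F₀`, all off the floor, of constant shade `2`, whose
steps are all CORNER steps (`b_k = 0`) from some index on.  (idea-4 I-4-4 (Q4)/(Q5) + I-4-5 (G1)–(G4), `p`-free; FT =
`FreeTailProof.noIsolatedFreeTailAt_self`.)  The translated steps (free translations / lost boundary letters) are NOT
treated here. [OURS · K2(p) phase d = 2] [folklore] -/
theorem no_shadeTwo_corner_chain (p : ℕ) [Fact p.Prime] (K : Type) [Field K] [CharP K p] [DecidableEq K]
    {c : ℕ → State K} {j : ℕ → Fin 4} {b : ℕ → Fin 4 → K} (hw : FreeTail.IsWitnessedChain p c j b)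
    (hc : ∀ k, IsIsolated p (c k).F ∧ ordZero (c k).F ≠ p ∧ (c k).shade = 2)
    (hr0 : ∀ e ∈ (c 0).F.support, (c 0).r ≤ e) {k₀ : ℕ} (hb : ∀ k, k₀ ≤ k → b k = 0) : False := by
  have hp : Fact p.Prime := inferInstance
  have hcs : ∀ k, IsIsolated p (c k).F ∧ Step0 p (c k) (c (k + 1)) ∧ ordZero (c k).F ≠ p ∧ (c k).shade = 2 :=
    fun k => ⟨(hc k).1, step0_of_isWitnessedChain hw k, (hc k).2.1, (hc k).2.2⟩
  have hc2 : ∀ k, IsIsolated p (c k).F ∧ Step0 p (c k) (c (k + 1)) := fun k => ⟨(hcs k).1, (hcs k).2.1⟩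
  -- re-root at `k₀`: all steps are corner steps
  have hw₁ : FreeTail.IsWitnessedChain p (fun k => c (k₀ + k)) (fun k => j (k₀ + k)) (fun k => b (k₀ + k)) :=
    fun k => hw (k₀ + k)
  have hcs₁ : ∀ k, IsIsolated p (c (k₀ + k)).F ∧ Step0 p (c (k₀ + k)) (c (k₀ + (k + 1))) ∧
      ordZero (c (k₀ + k)).F ≠ p ∧ (c (k₀ + k)).shade = 2 := fun k => hcs (k₀ + k)
  have hr₁ : ∀ e ∈ (c (k₀ + 0)).F.support, (c (k₀ + 0)).r ≤ e := IsolatedBand.isolated_chain_forall_le hc2 hr0 k₀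
  have hb₁ : ∀ k, b (k₀ + k) = 0 := fun k => hb (k₀ + k) (Nat.le_add_right _ _)
  -- the first change of chart (FT)
  have hFT := (FreeTail.satelliteRecurrenceAt_iff_noIsolatedFreeTailAt p p).mpr
    (FreeTailProof.noIsolatedFreeTailAt_self p)
  obtain ⟨k₁, -, hsat⟩ := hFT K _ _ _ hw₁ (fun k => (hcs₁ k).1) 0
  have hch : j (k₀ + k₁) ≠ j (k₀ + (k₁ + 1)) := fun h => hsat.1 h.symm
  -- beyond it every chart letter has co-weight `≤ p − 2`; re-root there and induct on the weight
  have H := fun k (hk : k₁ < k) =>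
    (degree_succ_le_of_change (c := fun k => c (k₀ + k)) (j := fun k => j (k₀ + k)) hw₁ hcs₁ hr₁ hb₁ hch k hk).1
  have hc2₁ : ∀ k, IsIsolated p (c (k₀ + k)).F ∧ Step0 p (c (k₀ + k)) (c (k₀ + (k + 1))) :=
    fun k => ⟨(hcs₁ k).1, (hcs₁ k).2.1⟩
  refine no_corner_chain_of_coweight_le (p := p) ((c (k₀ + (k₁ + 1 + 0))).r.degree)
    (fun i => c (k₀ + (k₁ + 1 + i))) (fun i => j (k₀ + (k₁ + 1 + i))) (fun i => b (k₀ + (k₁ + 1 + i)))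
    (fun i => hw₁ (k₁ + 1 + i)) (fun i => hcs₁ (k₁ + 1 + i))
    (IsolatedBand.isolated_chain_forall_le hc2₁ hr₁ (k₁ + 1)) (fun i => hb₁ (k₁ + 1 + i))
    (fun i => H (k₁ + 1 + i) (by omega)) le_rfl


end ResCone

end Summit.ResolutionOfSingularities.ResolutionOfSingularities.Theorems.PIDim4

end
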